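import Summits.ResolutionOfSingularities.ResolutionOfSingularities.Theorems.WeightedInvariantE2CentreHomOfNoEmbedded
import Summits.ResolutionOfSingularities.ResolutionOfSingularities.Theorems.WeightedInvariantE2NoEmbedded
import HarnessLib

/-!
# E2 centre: the word (G-6b) `e2CentreHom` PROVED and the registered stub `stub_e2_centre_h` CLOSED BY NAME

Route `ResolutionOfSingularities/WeightedInvariant`, crux `Theses.WeightedInvariant.HypersurfaceCentreConstruction`
(stmt-ResolutionOfSingularities-19897), door line `local-engine` (skeleton v3.12, 7a4b52ef4f5779aa), E2 tier.  The registered stub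
`stub_e2_centre_h : ∀ p, p.Prime → ∀ ι J, E2CentreH p ι J` rested on the single word (G-6b)
`PRungGrHomLE 3 p ι J → E2HomogeneousChartBody p ι J → E2CentreHomBody p ι J` (`stub_e2_centre_h_of_hom`, …ELadderTwoCentreOfHom).  (G-6b) is
…E2CentreHomOfNoEmbedded (`e2CentreHomBody_of_noEmbedded`: LEMMA H′ + the twist-stability kernel + reading propagation, from «(a″)») composed with
…E2NoEmbedded (`Stage.exists_assPoint_maximal`: «(a″)» from the local-model description of the maximal canonical centre).  Hence:
* `e2CentreHom` — the word (G-6b), for every prime `p` and every pair `(ι, J)`;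
* `stub_e2_centre_h` — THE REGISTERED STUB BY NAME (signature verbatim).
[OURS · L1 W4.3 · candidate-design support; the E2 tier is OUR construction, nothing here is a statement of Hironaka 2017; AI-written, weaker than expert
review; no claim about resolution of singularities in characteristic `p` beyond the typed statement.]
-/

noncomputable section

set_option linter.dupNamespace false -- mandated namespace of this single-conjunct summit

open Summit.ResolutionOfSingularities.ResolutionOfSingularities.Theorems
open Summit.ResolutionOfSingularities.ResolutionOfSingularities.Theorems.ELadderOne

namespace Summit.ResolutionOfSingularities.ResolutionOfSingularities.Cruxes.HypersurfaceCentreConstruction.LocalEngine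

/-- **The word (G-6b)**: under the graded HOM rung and the homogeneous charts (G-0), the stalkwise-maximal canonical e = 2 centre satisfies the
`(hom)` clause of admissibility for EVERY grading of EVERY affine open making `𝓘(X)` homogeneous. [folklore] -/
theorem e2CentreHom : ∀ p : ℕ, p.Prime → ∀ (ι : (R : Type) → [CommRing R] → R → Ordinal.{0})
    (J : (R : Type) → [CommRing R] → R → ℕ → Ideal R),
    PRungGrHomLE 3 p ι J → E2HomogeneousChartBody p ι J → E2CentreHomBody p ι J :=
  fun p _ ι J hr hG0 => e2CentreHomBody_of_noEmbedded p ι J hr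
    fun _ _ _ _ S h0 _ _ hR hmaxR W n _ h𝔮 => S.exists_assPoint_maximal ι J hr h0 hG0 hR hmaxR W n h𝔮

/-- **`stub_e2_centre_h` — the registered E2-centre stub of skeleton v3.12, BY NAME**: for every prime `p` and every pair `(ι, J)`,
`E2CentreH p ι J` (under the graded HOM rung for the pair, a non-regular stage with (I0)₂ carries an admissible canonical e = 2 centre off the generic
point).  From `e2CentreHom` via `stub_e2_centre_h_of_hom`. [folklore] -/
theorem stub_e2_centre_h : ∀ p : ℕ, p.Prime →
    ∀ (ι : (R : Type) → [CommRing R] → R → Ordinal.{0}) (J : (R : Type) → [CommRing R] → R → ℕ → Ideal R),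
      E2CentreH p ι J :=
  stub_e2_centre_h_of_hom e2CentreHom

end Summit.ResolutionOfSingularities.ResolutionOfSingularities.Cruxes.HypersurfaceCentreConstruction.LocalEngine

end
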